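import Summits.Parity.GeneralizedHardyLittlewood.Theorems.GreenTaoLevelTwoMNTwoVerticalOfLemma24
import Summits.Parity.GeneralizedHardyLittlewood.Theorems.GreenTaoLevelTwoMNTwoLemma24Poly

/-!
# Route `GreenTaoLevelTwo`, crux `MNTwo` (stmt-Parity-21276), line `birth`, stub `stub_mnVertical`:
# the stub from the Fourier expansion of Bohr-gauge Lipschitz cutoffs (GT 2008b, App. A Lemma 37)

FINAL REDUCTION of `stub_mnVertical` (B. Green, T. Tao, *Quadratic uniformity of the Möbius
function*, Ann. Inst. Fourier 58 (2008) = arXiv:math/0606087): the registered signature of the stub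
follows from ONE remaining printed fact, used for every torus dimension `k` — AIF Lemma 37
(Fourier approximation of Lipschitz functions) in the form needed for the Bohr-gauge cutoffs of
§9–§10: a weight `ψ : ℤ → [0,1]` that is Lipschitz for `ν(n) = maxᵢ‖nαᵢ‖ + |n|/N` and supported in
`B(n₀,ρ)` is, on `B(n₀,3ρ)`, within `δ` of a combination of `J ≤ Cf·δ^{-D}` characters `e(β_j n)`
with coefficients of norm `≤ 1` (`D, Cf` depending on `k` only).  Composition of
`…MNTwoVerticalOfLemma24.stub_mnVertical_of_lemma24` and `…MNTwoLemma24Poly.lemma24_poly`.  Def-free.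

* `stub_mnVertical_of_hfour` — the statement just described.

References: [GreenTao2008QuadraticMobius] arXiv:math/0606087 §2, §§8–12, App. A (Lemmas 36, 37).
-/

noncomputable section

open Finset Real ArithmeticFunction
open scoped ArithmeticFunction.Moebius FourierTransform ComplexConjugate
open Literature.NumberTheory.Sieve
open Literature.NumberTheory.Sieve.GreenTaoLevelTwo (HX IsCompatMetric IsBoxComparable heisenbergWith
  InHeisClass)

namespace Summit.Parity.GeneralizedHardyLittlewood.GreenTaoLevelTwoMNTwoVerticalOfFourier

open Summit.Parity.GeneralizedHardyLittlewood.GreenTaoLevelTwoMNTwoVerticalOfLemma24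
  (stub_mnVertical_of_lemma24)
open Summit.Parity.GeneralizedHardyLittlewood.GreenTaoLevelTwoMNTwoLemma24Poly (lemma24_poly)

/-- **`stub_mnVertical` from the Fourier expansion of Bohr-gauge Lipschitz cutoffs (all `k`).**
`hfour k` is AIF Lemma 37 for the cutoffs (module docstring); the conclusion is the registered
signature of `stub_mnVertical` verbatim.
[cite: GreenTao2008QuadraticMobius, §2, §§8–12, App. A Lemma 37] -/
theorem stub_mnVertical_of_hfour
    (hfour : ∀ k : ℕ, ∃ (D : ℕ) (Cf : ℝ), 1 ≤ Cf ∧ ∀ (N : ℕ) (α : Fin k → ℝ) (n₀ : ℤ) (ρ : ℝ), 0 < ρ →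
      ∀ (ψ : ℤ → ℝ), (∀ n, 0 ≤ ψ n) → (∀ n, ψ n ≤ 1) →
        (∀ n, ψ n ≠ 0 →
          (⨆ i : Fin k, ‖((((n - n₀ : ℤ) : ℝ) * α i : ℝ) : AddCircle (1 : ℝ))‖) +
            |((n - n₀ : ℤ) : ℝ)| / N < ρ) →
        (∀ n n' : ℤ, |ψ n - ψ n'| ≤
          (⨆ i : Fin k, ‖((((n - n' : ℤ) : ℝ) * α i : ℝ) : AddCircle (1 : ℝ))‖) +
            |((n - n' : ℤ) : ℝ)| / N) →
      ∀ δ : ℝ, 0 < δ → δ ≤ 1 → ∃ J : ℕ, 1 ≤ J ∧ (J : ℝ) ≤ Cf / δ ^ D ∧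
        ∃ (c : ℕ → ℂ) (β : ℕ → ℝ), (∀ j, ‖c j‖ ≤ 1) ∧ ∀ n : ℤ,
          (⨆ i : Fin k, ‖((((n - n₀ : ℤ) : ℝ) * α i : ℝ) : AddCircle (1 : ℝ))‖) +
              |((n - n₀ : ℤ) : ℝ)| / N < 3 * ρ →
            ‖((ψ n : ℝ) : ℂ) - ∑ j ∈ range J, c j * (𝐞 (β j * (n : ℝ)) : ℂ)‖ ≤ δ) :
    (∀ (d : HX → HX → ℝ) (h : IsCompatMetric d), IsBoxComparable d →
      ∀ X : Nilmanifold 2, InHeisClass (heisenbergWith d h) X → ∀ m : ℕ,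
        ∀ A : ℝ, 0 < A → ∃ C B : ℝ, ∀ M : ℝ, 1 ≤ M → ∀ N : ℕ, 2 ≤ N →
          ∀ (g : ((X.pow m).prod (Nilmanifold.circle.ofLE one_le_two)).G) (x : ((X.pow m).prod (Nilmanifold.circle.ofLE one_le_two)).G ⧸ ((X.pow m).prod (Nilmanifold.circle.ofLE one_le_two)).Γ) (F₁ F₂ : ((X.pow m).prod (Nilmanifold.circle.ofLE one_le_two)).G ⧸ ((X.pow m).prod (Nilmanifold.circle.ofLE one_le_two)).Γ → ℝ),
            ((X.pow m).prod (Nilmanifold.circle.ofLE one_le_two)).IsBoundedLipschitz M F₁ → ((X.pow m).prod (Nilmanifold.circle.ofLE one_le_two)).IsBoundedLipschitz M F₂ →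
            (∃ θ : ((X.pow m).prod (Nilmanifold.circle.ofLE one_le_two)).G → ℝ, ∀ z : ((X.pow m).prod (Nilmanifold.circle.ofLE one_le_two)).G, z ∈ Subgroup.center ((X.pow m).prod (Nilmanifold.circle.ofLE one_le_two)).G →
              ∀ x : ((X.pow m).prod (Nilmanifold.circle.ofLE one_le_two)).G ⧸ ((X.pow m).prod (Nilmanifold.circle.ofLE one_le_two)).Γ,
                ((F₁ (z • x) : ℂ) + (F₂ (z • x) : ℂ) * Complex.I) =
                  Complex.exp (2 * Real.pi * Complex.I * θ z) * ((F₁ x : ℂ) + (F₂ x : ℂ) * Complex.I)) →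
              ‖∑ n ∈ Finset.Icc 1 N, ((ArithmeticFunction.moebius n : ℝ) : ℂ) *
                  ((F₁ (g ^ n • x) : ℂ) + (F₂ (g ^ n • x) : ℂ) * Complex.I)‖ ≤
                C * M ^ B * N / Real.log N ^ A) :=
  stub_mnVertical_of_lemma24 fun k => lemma24_poly k (hfour k)

end Summit.Parity.GeneralizedHardyLittlewood.GreenTaoLevelTwoMNTwoVerticalOfFourier
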